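import Mathlib
import Literature.Analysis.ValidatedNumerics.TrigLogTables

/-!
# RiemannHypothesis / UniversalFactor — kernel certificate: the theta series `Φ_ℂ(iy)` changes sign on `(0.31, 0.33)`
(negative-side support for crux `LaplaceLoophole`, item stmt-RiemannHypothesis-2575)

With `s_m(y) := (2π²m⁴e^{9iy} − 3πm²e^{5iy}) exp(−πm²e^{4iy})` (the `m`-th term of the complex
continuation `Φ_ℂ(iy) = Σ_{m≥1} s_m(y)` of the Pólya–de Bruijn kernel), this file proves

  `0 < Re Σ_{m≥1} s_m(0.31)`  and  `Re Σ_{m≥1} s_m(0.33) < 0`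

(`UniversalFactor.PhiICert.re_tsum_pos_031`, `…re_tsum_neg_033`). The first twelve terms are enclosed in
the kernel-evaluable fixed-point interval arithmetic of
`Literature/Analysis/ValidatedNumerics/FixedPointInterval.lean` (`CB.expI`, `FI.expSmall` + squaring,
`FI.pi`; checked by `decide +kernel`), the tail `m ≥ 13` is bounded crudely by
`Σ 30e^{−4m} ≤ 60e^{−52} < 10⁻²` using only `cos(4y) ≥ 1/5`. Combined with the residue identity
`∫₀^∞ H_0 cosh(a·) = (π/2)Φ_ℂ(ia)` (`LaplaceLoopholeResidueSeries.lean`) and the intermediate value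
theorem this shows that the wide-window residue VANISHES at some `a₀ ∈ (0.31, 0.33)`
(numerically `a₀ = 0.3194150268…`): the exceptional branch `ExceptionalWideNoGo` of the kill path of
`LaplaceLoophole` is not vacuous.
-/

noncomputable section

namespace Summit.RiemannHypothesis.RiemannHypothesis.Theorems

open Literature.Analysis.ValidatedNumerics.Numerics
open Complex Real Finset

namespace UniversalFactor.PhiICert

/-! ## The checker (computable) -/

section Checker

/-- `E ↦ E^(2^k)` by `k` squarings. [folklore] -/
def sqIter (E : FI) : ℕ → FI
  | 0 => E
  | k + 1 => sqIter (E.sqr) k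

/-- `exp` on `[-2^k, 2^k]`: `exp x = (exp (x/2^k))^(2^k)`. [folklore] -/
def expSq (X : FI) (k : ℕ) : Option FI :=
  match FI.expSmall (X.divNat (2 ^ k)) with
  | some E => some (sqIter E k)
  | none => none

/-- Enclosures of `e^{9iy}, e^{5iy}, e^{4iy}, π, π²`. [folklore] -/
structure Data where
  /-- `∋ e^{9iy}` -/
  A : CB
  /-- `∋ e^{5iy}` -/
  B : CB
  /-- `∋ e^{4iy}` -/
  E : CB
  /-- `∋ π` -/
  piI : FI
  /-- `∋ π²` -/
  pi2 : FI

/-- Enclosure of the term `s_m(y) = (2π²m⁴e^{9iy} − 3πm²e^{5iy})·e^{−πm²cos 4y}·e^{−iπm² sin 4y}`.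
[folklore] -/
def termCB (D : Data) (m : ℕ) : Option CB :=
  let poly := ((D.A.mulFI D.pi2).mulInt (2 * (m : ℤ) ^ 4)).sub ((D.B.mulFI D.piI).mulInt (3 * (m : ℤ) ^ 2))
  match expSq ((D.piI.mul D.E.re).mulInt (-((m : ℤ) ^ 2))) 8 with
  | none => none
  | some g =>
    match CB.expI ((D.piI.mul D.E.im).mulInt (-((m : ℤ) ^ 2))) with
    | none => none
    | some h => some ((poly.mulFI g).mul h)

/-- Enclosure of `Σ_{m=1}^{N} s_m(y)`. [folklore] -/
def sumCB (D : Data) : ℕ → Option CB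
  | 0 => some (CB.ofInt 0)
  | n + 1 =>
    match sumCB D n, termCB D (n + 1) with
    | some s, some t => some (s.add t)
    | _, _ => none

/-- The data for a rational `y`. [folklore] -/
def mkData (y : ℚ) : Option Data :=
  match CB.expI (FI.ofRat (9 * y)), CB.expI (FI.ofRat (5 * y)), CB.expI (FI.ofRat (4 * y)) with
  | some A, some B, some E => some ⟨A, B, E, FI.pi, FI.pi.sqr⟩
  | _, _, _ => none

/-- `cos 4y ≥ 1/5` and `Re Σ_{m ≤ 12} s_m(y) > 1/100`, in interval arithmetic. [folklore] -/
def checkPos (y : ℚ) : Bool :=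
  match mkData y with
  | none => false
  | some D =>
    decide ((SC : ℤ) ≤ D.E.re.lo * 5) &&
    match sumCB D 12 with
    | some S => decide ((SC : ℤ) < S.re.lo * 100)
    | none => false

/-- `cos 4y ≥ 1/5` and `Re Σ_{m ≤ 12} s_m(y) < −1/100`, in interval arithmetic. [folklore] -/
def checkNeg (y : ℚ) : Bool :=
  match mkData y with
  | none => false
  | some D =>
    decide ((SC : ℤ) ≤ D.E.re.lo * 5) &&
    match sumCB D 12 with
    | some S => decide (S.re.hi * 100 < -(SC : ℤ))
    | none => false

end Checker

/-! ## Semantics and soundness of the checker -/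

/-- The `m`-th term of `Φ_ℂ` at `u = iy`. [folklore] -/
def term (m : ℕ) (y : ℝ) : ℂ :=
  (2 * π ^ 2 * (m : ℂ) ^ 4 * cexp (9 * (I * y)) - 3 * π * (m : ℂ) ^ 2 * cexp (5 * (I * y))) *
    cexp (-(π * (m : ℂ) ^ 2 * cexp (4 * (I * y))))

/-- Soundness of `sqIter`. [folklore] -/
theorem mem_sqIter {v : ℝ} {E : FI} (h : FI.mem v E) (k : ℕ) : FI.mem (v ^ (2 ^ k)) (sqIter E k) := by
  induction k generalizing v E with
  | zero => simpa [sqIter] using h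
  | succ k ih =>
    rw [show sqIter E (k + 1) = sqIter E.sqr k from rfl, pow_succ', pow_mul]
    exact ih (FI.mem_sqr h)

/-- Soundness of `expSq`. [folklore] -/
theorem mem_expSq {x : ℝ} {X Y : FI} {k : ℕ} (h : expSq X k = some Y) (hx : FI.mem x X) :
    FI.mem (Real.exp x) Y := by
  unfold expSq at h
  split at h
  · rename_i E hE
    simp only [Option.some.injEq] at h
    subst h
    have h1 : FI.mem (x / (2 ^ k : ℕ)) (X.divNat (2 ^ k)) := FI.mem_divNat hx (pow_pos (by norm_num) k)
    have h2 := FI.mem_expSmall hE h1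
    have h3 := mem_sqIter h2 k
    have h4 : Real.exp (x / (2 ^ k : ℕ)) ^ (2 ^ k) = Real.exp x := by
      rw [← Real.exp_nat_mul]
      congr 1
      push_cast
      field_simp
    rwa [h4] at h3
  · simp at h

/-- `e^{−πm²e^{4iy}} = e^{−πm²cos 4y} · e^{−iπm² sin 4y}`. [folklore] -/
theorem cexp_neg_pi_sq_eq (m : ℕ) (y : ℝ) :
    cexp (-(π * (m : ℂ) ^ 2 * cexp (4 * (I * y)))) =
      (Real.exp (π * Real.cos (4 * y) * ((-((m : ℤ) ^ 2) : ℤ) : ℝ)) : ℂ) *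
        cexp (((π * Real.sin (4 * y) * ((-((m : ℤ) ^ 2) : ℤ) : ℝ) : ℝ) : ℂ) * I) := by
  rw [Complex.ofReal_exp, ← Complex.exp_add]
  congr 1
  have h4 : (4 * (I * (y : ℂ))) = ((4 * y : ℝ) : ℂ) * I := by push_cast; ring
  rw [h4, Complex.exp_mul_I, ← Complex.ofReal_cos, ← Complex.ofReal_sin]
  push_cast
  ring

/-- Soundness of `termCB`. [folklore] -/
theorem mem_termCB {y : ℝ} {D : Data} (hA : CB.mem (cexp (9 * (I * y))) D.A)
    (hB : CB.mem (cexp (5 * (I * y))) D.B) (hE : CB.mem (cexp (4 * (I * y))) D.E)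
    (hpi : FI.mem π D.piI) (hpi2 : FI.mem (π ^ 2) D.pi2) {m : ℕ} {T : CB} (h : termCB D m = some T) :
    CB.mem (term m y) T := by
  unfold termCB at h
  simp only at h
  split at h
  · simp at h
  · rename_i g hg
    split at h
    · simp at h
    · rename_i hh hexp
      simp only [Option.some.injEq] at h
      subst h
      -- the polynomial factor
      have hpoly : CB.mem (cexp (9 * (I * y)) * ((π ^ 2 : ℝ) : ℂ) * ((2 * (m : ℤ) ^ 4 : ℤ) : ℂ) -
          cexp (5 * (I * y)) * ((π : ℝ) : ℂ) * ((3 * (m : ℤ) ^ 2 : ℤ) : ℂ))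
          (((D.A.mulFI D.pi2).mulInt (2 * (m : ℤ) ^ 4)).sub ((D.B.mulFI D.piI).mulInt (3 * (m : ℤ) ^ 2))) :=
        CB.mem_sub (CB.mem_mulInt (CB.mem_mulFI hA hpi2) (2 * (m : ℤ) ^ 4))
          (CB.mem_mulInt (CB.mem_mulFI hB hpi) (3 * (m : ℤ) ^ 2))
      -- the Gaussian modulus
      have hre : FI.mem (Real.cos (4 * y)) D.E.re := by
        have := hE.1
        have e : (cexp (4 * (I * (y : ℂ)))).re = Real.cos (4 * y) := by
          rw [show (4 * (I * (y : ℂ))) = ((4 * y : ℝ) : ℂ) * I by push_cast; ring, Complex.exp_ofReal_mul_I_re]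
        rwa [e] at this
      have him : FI.mem (Real.sin (4 * y)) D.E.im := by
        have := hE.2
        have e : (cexp (4 * (I * (y : ℂ)))).im = Real.sin (4 * y) := by
          rw [show (4 * (I * (y : ℂ))) = ((4 * y : ℝ) : ℂ) * I by push_cast; ring, Complex.exp_ofReal_mul_I_im]
        rwa [e] at this
      have hg' : FI.mem (Real.exp (π * Real.cos (4 * y) * ((-((m : ℤ) ^ 2) : ℤ) : ℝ))) g :=
        mem_expSq hg (FI.mem_mulInt (FI.mem_mul hpi hre) (-((m : ℤ) ^ 2)))
      have hh' : CB.mem (cexp (((π * Real.sin (4 * y) * ((-((m : ℤ) ^ 2) : ℤ) : ℝ) : ℝ) : ℂ) * I)) hh :=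
        CB.mem_expI hexp (FI.mem_mulInt (FI.mem_mul hpi him) (-((m : ℤ) ^ 2)))
      have hall := CB.mem_mul (CB.mem_mulFI hpoly hg') hh'
      have e : term m y = (cexp (9 * (I * y)) * ((π ^ 2 : ℝ) : ℂ) * ((2 * (m : ℤ) ^ 4 : ℤ) : ℂ) -
          cexp (5 * (I * y)) * ((π : ℝ) : ℂ) * ((3 * (m : ℤ) ^ 2 : ℤ) : ℂ)) *
          (Real.exp (π * Real.cos (4 * y) * ((-((m : ℤ) ^ 2) : ℤ) : ℝ)) : ℂ) *
          cexp (((π * Real.sin (4 * y) * ((-((m : ℤ) ^ 2) : ℤ) : ℝ) : ℝ) : ℂ) * I) := by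
        rw [term, cexp_neg_pi_sq_eq, ← mul_assoc]
        congr 1
        push_cast
        ring
      rwa [e]

/-- Soundness of `sumCB`. [folklore] -/
theorem mem_sumCB {y : ℝ} {D : Data} (hA : CB.mem (cexp (9 * (I * y))) D.A)
    (hB : CB.mem (cexp (5 * (I * y))) D.B) (hE : CB.mem (cexp (4 * (I * y))) D.E)
    (hpi : FI.mem π D.piI) (hpi2 : FI.mem (π ^ 2) D.pi2) {N : ℕ} {S : CB} (h : sumCB D N = some S) :
    CB.mem (∑ n ∈ Finset.range N, term (n + 1) y) S := by
  induction N generalizing S with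
  | zero =>
    simp only [sumCB, Option.some.injEq] at h
    subst h
    simpa using CB.mem_ofInt 0
  | succ n ih =>
    simp only [sumCB] at h
    split at h
    · rename_i s t hs ht
      simp only [Option.some.injEq] at h
      subst h
      rw [Finset.sum_range_succ]
      exact CB.mem_add (ih hs) (mem_termCB hA hB hE hpi hpi2 ht)
    · simp at h

/-- Soundness of `mkData`. [folklore] -/
theorem mkData_ok {q : ℚ} {D : Data} (h : mkData q = some D) :
    CB.mem (cexp (9 * (I * (q : ℝ)))) D.A ∧ CB.mem (cexp (5 * (I * (q : ℝ)))) D.B ∧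
      CB.mem (cexp (4 * (I * (q : ℝ)))) D.E ∧ FI.mem π D.piI ∧ FI.mem (π ^ 2) D.pi2 := by
  unfold mkData at h
  split at h
  · rename_i A B E hA hB hE
    simp only [Option.some.injEq] at h
    subst h
    have eA : cexp (9 * (I * ((q : ℝ) : ℂ))) = cexp ((((9 * q : ℚ) : ℝ) : ℂ) * I) := by
      congr 1; push_cast; ring
    have eB : cexp (5 * (I * ((q : ℝ) : ℂ))) = cexp ((((5 * q : ℚ) : ℝ) : ℂ) * I) := by
      congr 1; push_cast; ring
    have eE : cexp (4 * (I * ((q : ℝ) : ℂ))) = cexp ((((4 * q : ℚ) : ℝ) : ℂ) * I) := by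
      congr 1; push_cast; ring
    exact ⟨eA ▸ CB.mem_expI hA (FI.mem_ofRat _), eB ▸ CB.mem_expI hB (FI.mem_ofRat _),
      eE ▸ CB.mem_expI hE (FI.mem_ofRat _), FI.mem_pi, by simpa using FI.mem_sqr FI.mem_pi⟩
  · simp at h

/-- Soundness of `checkPos`: `cos 4y ≥ 1/5` and `Re Σ_{m=1}^{12} s_m(y) > 1/100`. [folklore] -/
theorem checkPos_sound {q : ℚ} (h : checkPos q = true) :
    1 / 5 ≤ Real.cos (4 * (q : ℝ)) ∧ 1 / 100 < (∑ n ∈ Finset.range 12, term (n + 1) (q : ℝ)).re := by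
  unfold checkPos at h
  split at h
  · simp at h
  · rename_i D hD
    obtain ⟨hA, hB, hE, hpi, hpi2⟩ := mkData_ok hD
    rw [Bool.and_eq_true, decide_eq_true_eq] at h
    obtain ⟨h1, h2⟩ := h
    split at h2
    · rename_i S hS
      rw [decide_eq_true_eq] at h2
      have hmem := mem_sumCB hA hB hE hpi hpi2 hS
      have hre : FI.mem (Real.cos (4 * (q:ℝ))) D.E.re := by
        have := hE.1
        have e : (cexp (4 * (I * ((q : ℝ) : ℂ)))).re = Real.cos (4 * (q : ℝ)) := by
          rw [show (4 * (I * ((q:ℝ) : ℂ))) = ((4 * (q:ℝ) : ℝ) : ℂ) * I by push_cast; ring,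
            Complex.exp_ofReal_mul_I_re]
        rwa [e] at this
      have hSC := SC_pos
      constructor
      · have hlo := hre.1
        have h1' : ((SC : ℤ) : ℝ) ≤ (D.E.re.lo : ℝ) * 5 := by exact_mod_cast h1
        push_cast at h1'
        nlinarith
      · have hlo := hmem.1.1
        have h2' : ((SC : ℤ) : ℝ) < (S.re.lo : ℝ) * 100 := by exact_mod_cast h2
        push_cast at h2'
        nlinarith
    · simp at h2

/-- Soundness of `checkNeg`. [folklore] -/
theorem checkNeg_sound {q : ℚ} (h : checkNeg q = true) :
    1 / 5 ≤ Real.cos (4 * (q : ℝ)) ∧ (∑ n ∈ Finset.range 12, term (n + 1) (q : ℝ)).re < -(1 / 100) := by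
  unfold checkNeg at h
  split at h
  · simp at h
  · rename_i D hD
    obtain ⟨hA, hB, hE, hpi, hpi2⟩ := mkData_ok hD
    rw [Bool.and_eq_true, decide_eq_true_eq] at h
    obtain ⟨h1, h2⟩ := h
    split at h2
    · rename_i S hS
      rw [decide_eq_true_eq] at h2
      have hmem := mem_sumCB hA hB hE hpi hpi2 hS
      have hre : FI.mem (Real.cos (4 * (q:ℝ))) D.E.re := by
        have := hE.1
        have e : (cexp (4 * (I * ((q : ℝ) : ℂ)))).re = Real.cos (4 * (q : ℝ)) := by
          rw [show (4 * (I * ((q:ℝ) : ℂ))) = ((4 * (q:ℝ) : ℝ) : ℂ) * I by push_cast; ring,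
            Complex.exp_ofReal_mul_I_re]
        rwa [e] at this
      have hSC := SC_pos
      constructor
      · have hlo := hre.1
        have h1' : ((SC : ℤ) : ℝ) ≤ (D.E.re.lo : ℝ) * 5 := by exact_mod_cast h1
        push_cast at h1'
        nlinarith
      · have hhi := hmem.1.2
        have h2' : (S.re.hi : ℝ) * 100 < -((SC : ℤ) : ℝ) := by exact_mod_cast h2
        push_cast at h2'
        nlinarith
    · simp at h2

/-! ## The kernel accepts the two certificates -/

/-- **The kernel accepts the certificate at `y = 0.31`.** [folklore] -/
theorem checkPos_031 : checkPos (31 / 100) = true := by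
  decide +kernel

/-- **The kernel accepts the certificate at `y = 0.33`.** [folklore] -/
theorem checkNeg_033 : checkNeg (33 / 100) = true := by
  decide +kernel


end UniversalFactor.PhiICert

end Summit.RiemannHypothesis.RiemannHypothesis.Theorems
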